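import Summits.BirchSwinnertonDyer.Rank1Residual.Additive.LocalTorsionAnomalousThree
import Summits.BirchSwinnertonDyer.Rank1Residual.Additive.AnomalousPointCountThree
import Summits.BirchSwinnertonDyer.Rank1Residual.Additive.ReductionNonAnomalousTwist
import Summits.BirchSwinnertonDyer.Rank1Residual.Additive.GordRankZeroChiBranch
import Summits.BirchSwinnertonDyer.Rank1Residual.Additive.TypeGThreeUnitJ
import Summits.BirchSwinnertonDyer.Rank1Residual.Additive.GordTorsionAnomalous
import Summits.BirchSwinnertonDyer.Rank1Residual.AdditivePotMult.TwistSupply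
import HarnessLib

/-!
# THE TORSION EXCEPTION IS ANOMALOUS AT `p = 3` TOO: a rational `3`-torsion point on a (G)-pair
# `(E, 3)` forces the good twist `E^{(−3)}` to be ORDINARY and ANOMALOUS at `3`
# (`a₃(E^{(−3)}) ≡ 1 (mod 3)`), so `ReductionNonAnomalous W 3 ⟹ E(ℚ₃)[3] = 0 ∧ t = 0`

HONEST FRAMING (cell `b2b-bsdres`, run/shared/lean/b2b/bsd-rank1-residual/, verbatim in every
file): the goal of the cell is to DELETE the COMBINATION-SHAPED residual classes of the
Birch–Swinnerton-Dyer formula for ALL analytic-rank `≤ 1` elliptic curves over `ℚ` — "full BSD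
formula for every rank `≤ 1` curve in class `C`" assembled STRICTLY from published theorems — so
that the rank-`≤ 1` remainder becomes exactly the CONSTRUCTION-SHAPED classes, which are TYPED
(missing-input `Prop`s), NOT attempted. This is not "finishing BSD". Sub-cell `additive-p2`
(X3♯(G-ord) / X4♯(G-ord)), generation 39: research route; no claim beyond the stated classes;
theorems only, no definition, no named fact, nothing booked, no label moved.

## What and why

Generation 38 (`Additive/GordTorsionAnomalous`) proved, at every `p ≥ 5`, that a `ℚ_p`-rational
`p`-torsion point on a (G)-pair forces ANOMALOUS reduction over the (G)-field, so that Delbourgo's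
proviso `ReductionNonAnomalous W p` (J. Number Theory 95 (2002) p. 39: the factor `ℓ_p(E)`) kills
the torsion term `2t` of every exact leading-term statement of the sub-cell.  At `p = 3` — where
rational `3`-torsion is the RULE on the (G)-cell (census: 214 of 421 (G-ord) classes N < 2·10⁴;
generation 37's "real boundary") — the cusp-jet mechanism of generations 37–38 is not available
(`e = p − 1`, no `3`-integral short model).  This file proves the `p = 3` twin by the elementary
route recorded in ENDSTATE §4 [gen 38] (θ), through the good twist `V ≅ E^{(−3)}`:

* **`three_dvd_b₂_sub_one_of_model_twist_of_three_zsmul_eq_zero`** — `W`, `V` over `ℚ`, `V`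
  globally minimal and GOOD at `3`, `C • V^{(−3)} = W`: a point `P ≠ O` of `E(ℚ₃)` with `3 • P = O`
  forces **`b₂(V_ℤ) ≡ 1 (mod 3)`** (`Additive/LocalTorsionAnomalousThree` on the `3`-integral model
  `Y² = X³ − 3b₂X² + 72b₄X − 432b₆` of `E`, which is `(u = ½) • V^{(−3)}`);
* hence (`Additive/AnomalousPointCountThree`: over `𝔽₃` the trace IS `b₂`)
  **`three_dvd_frobeniusTrace_sub_one_…`**: `a₃(V) ≡ 1 (mod 3)` — the twist is ANOMALOUS at `3` —,
  `3 ∣ #Ṽ(𝔽₃)`, and **`goodOrd_of_model_twist_…`**: `V` is good ORDINARY at `3` (for free);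
* on the (G)-cell (`TypeG W 3`, `Addv W 3`; `e = 2` automatic, `Additive/TypeGThree`):
  **`TypeG.not_reductionNonAnomalous_three_of_prime_zsmul_eq_zero`** (n1011-p10's defect-2
  dictionary `reductionNonAnomalous_iff_of_semistabilityIndex_eq_two`: the reduction over `ℚ(√−3)`
  is `Ṽ`), **`TypeG.typeGOrd_three_of_prime_zsmul_eq_zero`** ((G) + `3`-torsion ⟹ (G)-ORDINARY),
  and under the proviso: **`TypeG.eq_zero_of_three_nsmul_eq_zero_of_reductionNonAnomalous`**
  (`E(ℚ₃)[3] = 0`), **`TypeG.padicValNat_torsionOrder_three_eq_zero_of_reductionNonAnomalous`**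
  (`t = ord₃ #E(ℚ)_tors = 0`), with the X3♯(G-ord) / X4♯(G-ord) class forms.

So on the WHOLE (G)-cell at EVERY odd `p` the two provisos of Delbourgo (B) clause 3 collapse to
one: `ReductionNonAnomalous W p ⟹ t = 0` (`p ≥ 5`: generation 38; `p = 3`: here; the uniform
statements are drawn in `Additive/GordTorsionAnomalousOdd`).  EVIDENCE (generation 38,
`gen38/p3_check.py`, zero compute): the 214 (G-ord) classes at `3` with a `3`-torsion member are
214/214 anomalous over `ℚ(√−3)` by PARI point counts — now a theorem.

References: [Mazur1977] B. Mazur, Publ. Math. IHÉS 47 (1977), Ch. III §5, Step 1, p. 158 (method);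
[Delbourgo2002] D. Delbourgo, J. Number Theory 95 (2002), p. 39 (`ℓ_p(E)`), Thm (B);
[Delbourgo1998] D. Delbourgo, Compositio Math. 113 (1998) §1.5 (types (G), (M));
[Mazur1972] B. Mazur, Invent. Math. 18 (1972) §1 (anomalous primes); [SilvermanAEC2009] X.5.4,
VII.3.1, Exercise 3.7.
-/

noncomputable section

open scoped Classical NumberField

namespace Summit.BirchSwinnertonDyer.Rank1Residual.Additive

open WeierstrassCurve IsDedekindDomain NumberField Literature.NumberTheory.EllipticCurves
  Literature.NumberTheory.EllipticCurves.Rank1Residual AdditivePotMult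

/-! ## §1 `ℤ ↔ ℤ₃` bookkeeping -/

/-- `3 ∣ k` in `ℤ₃` iff `3 ∣ k` in `ℤ` (`‖k‖₃ < 1`). [folklore] -/
theorem three_dvd_intCast_padicInt_iff [Fact (Nat.Prime 3)] (k : ℤ) :
    (3 : ℤ_[3]) ∣ (k : ℤ_[3]) ↔ (3 : ℤ) ∣ k := by
  have h1 := PadicInt.norm_lt_one_iff_dvd (p := 3) (k : ℤ_[3])
  have h2 := PadicInt.norm_int_lt_one_iff_dvd (p := 3) k
  push_cast at h1 h2
  rw [← h1, h2]

variable (W : WeierstrassCurve ℚ) [W.IsElliptic] (V : WeierstrassCurve ℚ) [V.IsGloballyMinimal]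

/-! ## §2 `E = V^{(−3)}`, `V` good at `3`: a `3`-torsion point in `E(ℚ₃)` forces `b₂(V) ≡ 1 (mod 3)` -/

/-- **`W ≅ V^{(−3)}` over `ℚ` with `V` globally minimal and GOOD at `3`: a point `P ≠ O` of `W(ℚ₃)`
with `3 • P = O` forces `3 ∣ b₂(V_ℤ) − 1`.** The `3`-integral model
`T : Y² = X³ − 3b₂X² + 72b₄X − 432b₆` (`bᵢ = bᵢ(V_ℤ)`) is `(u = ½) • V^{(−3)}`, hence
`ℚ₃`-isomorphic to `W`; its cubic `x³ + b₂x² + 8b₄x + 16b₆` has discriminant `256·Δ_min(V)`, a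
`3`-adic unit (gen 10's `disc_b_eq`); `Additive/LocalTorsionAnomalousThree` does the rest.
[cite: Mazur1977, Ch. III §5, Step 1, p. 158 (method); SilvermanAEC2009, X.5 Cor. 5.4, VII.3 Prop. 3.1, Exercise 3.7(d),(f)] -/
theorem three_dvd_b₂_sub_one_of_model_twist_of_three_zsmul_eq_zero [Fact (Nat.Prime 3)]
    (hWV : ∃ C : VariableChange ℚ, C • V.quadraticTwist (-3) = W) (hV : V.HasGoodReductionAtPrime 3)
    {P : (W.baseChange ℚ_[3]).toAffine.Point} (hP0 : P ≠ 0) (hP : (3 : ℤ) • P = 0) :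
    (3 : ℤ) ∣ (integralModelInt V).b₂ - 1 := by
  obtain ⟨C, hC⟩ := hWV
  set E₀ : WeierstrassCurve ℤ := integralModelInt V with hE₀
  -- the `3`-integral twist model over `ℤ`, over `ℤ₃` and over `ℚ`
  set Tℤ : WeierstrassCurve ℤ := ⟨0, -(3 * E₀.b₂), 0, 9 * (8 * E₀.b₄), -(27 * (16 * E₀.b₆))⟩
    with hTℤ
  set T : WeierstrassCurve ℤ_[3] := Tℤ.map (Int.castRingHom ℤ_[3]) with hT
  have hb₂ : V.b₂ = (E₀.b₂ : ℚ) := by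
    have h := E₀.map_b₂ (Int.castRingHom ℚ); rw [hE₀, map_integralModelInt, eq_intCast] at h
    exact h
  have hb₄ : V.b₄ = (E₀.b₄ : ℚ) := by
    have h := E₀.map_b₄ (Int.castRingHom ℚ); rw [hE₀, map_integralModelInt, eq_intCast] at h
    exact h
  have hb₆ : V.b₆ = (E₀.b₆ : ℚ) := by
    have h := E₀.map_b₆ (Int.castRingHom ℚ); rw [hE₀, map_integralModelInt, eq_intCast] at h
    exact h
  -- `(u = ½) • V^{(−3)} = Tℤ ⊗ ℚ`
  set Ch : VariableChange ℚ := ⟨⟨(1 / 2 : ℚ), 2, by norm_num, by norm_num⟩, 0, 0, 0⟩ with hCh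
  have hu : ((Ch.u⁻¹ : ℚˣ) : ℚ) = 2 := rfl
  have hTℚ : Ch • V.quadraticTwist (-3) = Tℤ.map (Int.castRingHom ℚ) := by
    ext
    · simp [variableChange_a₁, hCh, hTℤ]
    · rw [variableChange_a₂, hu]; simp [hCh, hTℤ, hb₂]; ring
    · simp [variableChange_a₃, hCh, hTℤ]
    · rw [variableChange_a₄, hu]; simp [hCh, hTℤ, hb₄]; ring
    · rw [variableChange_a₆, hu]; simp [hCh, hTℤ, hb₆]; ring
  -- `W = (C * Ch⁻¹) • (Tℤ ⊗ ℚ)`, and over `ℚ₃`: `D • T_{ℚ₃} = W_{ℚ₃}`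
  have hW : (C * Ch⁻¹) • Tℤ.map (Int.castRingHom ℚ) = W := by
    rw [← hTℚ, mul_smul, smul_smul Ch⁻¹, inv_mul_cancel, one_smul, hC]
  have hTT : (Tℤ.map (Int.castRingHom ℚ)).baseChange ℚ_[3] = T.baseChange ℚ_[3] := by
    rw [baseChange, baseChange, hT, map_map, map_map,
      RingHom.ext_int ((algebraMap ℚ ℚ_[3]).comp (Int.castRingHom ℚ))
        ((algebraMap ℤ_[3] ℚ_[3]).comp (Int.castRingHom ℤ_[3]))]
  have hX : ((C * Ch⁻¹).map (algebraMap ℚ ℚ_[3])) • T.baseChange ℚ_[3] = W.baseChange ℚ_[3] := by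
    rw [← hTT, baseChange, map_variableChange, hW, baseChange]
  haveI : (W.baseChange ℚ_[3]).IsElliptic := by rw [baseChange]; infer_instance
  -- the hypotheses of the local theorem
  have ha₂ : T.a₂ = -(3 * (E₀.b₂ : ℤ_[3])) := by simp [hT, hTℤ]
  have ha₄ : T.a₄ = 9 * ((8 * E₀.b₄ : ℤ) : ℤ_[3]) := by simp [hT, hTℤ]
  have ha₆ : T.a₆ = -(27 * ((16 * E₀.b₆ : ℤ) : ℤ_[3])) := by simp [hT, hTℤ]
  have hΔ : ¬ (3 : ℤ_[3]) ∣ (E₀.b₂ : ℤ_[3]) ^ 2 * ((8 * E₀.b₄ : ℤ) : ℤ_[3]) ^ 2 -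
      4 * ((8 * E₀.b₄ : ℤ) : ℤ_[3]) ^ 3 - 4 * (E₀.b₂ : ℤ_[3]) ^ 3 * ((16 * E₀.b₆ : ℤ) : ℤ_[3]) -
      27 * ((16 * E₀.b₆ : ℤ) : ℤ_[3]) ^ 2 +
      18 * (E₀.b₂ : ℤ_[3]) * ((8 * E₀.b₄ : ℤ) : ℤ_[3]) * ((16 * E₀.b₆ : ℤ) : ℤ_[3]) := by
    have hgood : ¬ (3 : ℤ) ∣ E₀.Δ := by
      have h := not_dvd_minimalDiscriminantInt_of_hasGoodReductionAtPrime (W := V) 3 hV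
      rwa [minimalDiscriminantInt, ← hE₀, Nat.cast_ofNat] at h
    have hcast : (E₀.b₂ : ℤ_[3]) ^ 2 * ((8 * E₀.b₄ : ℤ) : ℤ_[3]) ^ 2 -
        4 * ((8 * E₀.b₄ : ℤ) : ℤ_[3]) ^ 3 - 4 * (E₀.b₂ : ℤ_[3]) ^ 3 * ((16 * E₀.b₆ : ℤ) : ℤ_[3]) -
        27 * ((16 * E₀.b₆ : ℤ) : ℤ_[3]) ^ 2 +
        18 * (E₀.b₂ : ℤ_[3]) * ((8 * E₀.b₄ : ℤ) : ℤ_[3]) * ((16 * E₀.b₆ : ℤ) : ℤ_[3]) =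
        ((256 * E₀.Δ : ℤ) : ℤ_[3]) := by
      rw [← disc_b_eq E₀]; push_cast; ring
    rw [hcast, three_dvd_intCast_padicInt_iff]
    intro h3
    rcases (Int.prime_three.dvd_or_dvd h3) with h | h
    · norm_num at h
    · exact hgood h
  have key := TorsionThree.three_dvd_sub_one_of_three_zsmul_eq_zero_of_variableChange T
    (B₂ := (E₀.b₂ : ℤ_[3])) (B₄ := ((8 * E₀.b₄ : ℤ) : ℤ_[3])) (B₆ := ((16 * E₀.b₆ : ℤ) : ℤ_[3]))
    (by simp [hT, hTℤ]) ha₂ (by simp [hT, hTℤ]) ha₄ ha₆ hΔ _ hX hP0 hP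
  rw [← Int.cast_one, ← Int.cast_sub, three_dvd_intCast_padicInt_iff] at key
  exact key

/-- **… hence `a₃(V) ≡ 1 (mod 3)`: the good twist `V ≅ E^{(−3)}` is ANOMALOUS at `3`** (over `𝔽₃`
the trace is `b₂`, `Additive/AnomalousPointCountThree`). [cite: Mazur1972, §1 (anomalous primes)] -/
theorem three_dvd_frobeniusTrace_sub_one_of_model_twist_of_three_zsmul_eq_zero
    [Fact (Nat.Prime 3)] (hWV : ∃ C : VariableChange ℚ, C • V.quadraticTwist (-3) = W)
    (hV : V.HasGoodReductionAtPrime 3) {P : (W.baseChange ℚ_[3]).toAffine.Point} (hP0 : P ≠ 0)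
    (hP : (3 : ℤ) • P = 0) : (3 : ℤ) ∣ V.frobeniusTrace 3 - 1 := by
  have hΔ : ¬ (3 : ℤ) ∣ minimalDiscriminantInt V := by
    have h := not_dvd_minimalDiscriminantInt_of_hasGoodReductionAtPrime (W := V) 3 hV
    rwa [Nat.cast_ofNat] at h
  exact (DeuringThree.three_dvd_frobeniusTrace_sub_one_iff_dvd_b₂_sub_one V hΔ).mpr
    (three_dvd_b₂_sub_one_of_model_twist_of_three_zsmul_eq_zero W V hWV hV hP0 hP)

/-- **… hence `3 ∣ #Ṽ(𝔽₃)`** (the reduction of the good twist has a rational `3`-torsion point).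
[cite: Mazur1972, §1 (anomalous primes)] -/
theorem three_dvd_reductionPointCount_of_model_twist_of_three_zsmul_eq_zero
    [Fact (Nat.Prime 3)] (hWV : ∃ C : VariableChange ℚ, C • V.quadraticTwist (-3) = W)
    (hV : V.HasGoodReductionAtPrime 3) {P : (W.baseChange ℚ_[3]).toAffine.Point} (hP0 : P ≠ 0)
    (hP : (3 : ℤ) • P = 0) : 3 ∣ reductionPointCount V 3 := by
  have hΔ : ¬ (3 : ℤ) ∣ minimalDiscriminantInt V := by
    have h := not_dvd_minimalDiscriminantInt_of_hasGoodReductionAtPrime (W := V) 3 hV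
    rwa [Nat.cast_ofNat] at h
  exact (DeuringThree.three_dvd_reductionPointCount_iff_dvd_b₂_sub_one V hΔ).mpr
    (three_dvd_b₂_sub_one_of_model_twist_of_three_zsmul_eq_zero W V hWV hV hP0 hP)

/-- **… hence the good twist `V ≅ E^{(−3)}` is good ORDINARY at `3`** (`a₃ ≡ 1 ≢ 0 (mod 3)`):
ordinarity comes for free from a `3`-torsion point. [cite: Mazur1972, §1 (anomalous primes)] -/
theorem goodOrd_of_model_twist_of_three_zsmul_eq_zero [Fact (Nat.Prime 3)]
    (hWV : ∃ C : VariableChange ℚ, C • V.quadraticTwist (-3) = W) (hV : V.HasGoodReductionAtPrime 3)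
    {P : (W.baseChange ℚ_[3]).toAffine.Point} (hP0 : P ≠ 0) (hP : (3 : ℤ) • P = 0) :
    GoodOrd V 3 := by
  refine ⟨hV, fun h3 => ?_⟩
  have h1 := three_dvd_frobeniusTrace_sub_one_of_model_twist_of_three_zsmul_eq_zero W V hWV hV hP0 hP
  have h : (3 : ℤ) ∣ 1 := by
    have e : (1 : ℤ) = V.frobeniusTrace 3 - (V.frobeniusTrace 3 - 1) := by ring
    rw [e]
    exact dvd_sub (by exact_mod_cast h3) h1
  norm_num at h

/-! ## §3 The (G)-cell at `3`: `3`-torsion ⟹ anomalous (and ordinary) -/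

variable {W} [W.IsGloballyMinimal]

/-- **(G) at `3`, `E` additive, and a `ℚ₃`-point `P ≠ O` with `3 • P = O` ⟹ the reduction over the
(G)-field `ℚ(√−3) ⊆ ℚ(ζ₃)` is ANOMALOUS: `¬ ReductionNonAnomalous W 3`.** The pair is `I₀*` (`e = 2`,
`semistabilityIndex_eq_two_of_typeG_three`), the twist `V ≅ E^{(−3)}` is good at `3`
(`hasGoodReductionAtPrime_twist_three_of_typeG_of_addv`), `3 ∣ #Ṽ(𝔽₃)` (§2), and the reduction of
`E` at the place of `ℚ(√−3)` over `3` IS `Ṽ` (`reductionNonAnomalous_iff_of_semistabilityIndex_eq_two`).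
[cite: Delbourgo2002, p. 39 (definition of ℓ_p(E)); Mazur1977, Ch. III §5, Step 1, p. 158 (method)] -/
theorem TypeG.not_reductionNonAnomalous_three_of_prime_zsmul_eq_zero [Fact (Nat.Prime 3)]
    (hG : TypeG W 3) (hadd : Addv W 3) {P : (W.baseChange ℚ_[3]).toAffine.Point} (hP0 : P ≠ 0)
    (hP : (3 : ℤ) • P = 0) : ¬ Delbourgo2002.ReductionNonAnomalous W 3 := by
  have hd : ((-1 : ℚ) ^ ((3 : ℕ) / 2) * (3 : ℕ)) ≠ 0 := by norm_num
  obtain ⟨V, iV, iVm, C₁, hC₁⟩ := exists_globallyMinimal_model_twist W hd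
  have hV : V.HasGoodReductionAtPrime 3 :=
    hasGoodReductionAtPrime_twist_three_of_typeG_of_addv W hG hadd V ⟨C₁, hC₁⟩
  obtain ⟨C, hC⟩ := exists_variableChange_twist_of_model_twist W hd hC₁
  have hC' : ∃ C : VariableChange ℚ, C • V.quadraticTwist (-3) = W :=
    ⟨C, by have h := hC; norm_num at h ⊢; exact h⟩
  have he := semistabilityIndex_eq_two_of_typeG_three W hG hadd
  intro hR
  exact (reductionNonAnomalous_iff_of_semistabilityIndex_eq_two W 3 (by decide) he V ⟨C, hC⟩ hV).mp
    hR (three_dvd_reductionPointCount_of_model_twist_of_three_zsmul_eq_zero W V hC' hV hP0 hP)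

/-- **(G) at `3` + a `3`-torsion point in `E(ℚ₃)` ⟹ (G)-ORDINARY** (`TypeGOrd W 3`): the good twist
`E^{(−3)}` is ordinary at `3` (`goodOrd_of_model_twist_of_three_zsmul_eq_zero`, gen 0's
`typeGOrd_of_goodOrd_quadraticTwist`). [cite: Delbourgo1998, §1.5 (types (G), (M)); Mazur1972, §1] -/
theorem TypeG.typeGOrd_three_of_prime_zsmul_eq_zero [Fact (Nat.Prime 3)] (hG : TypeG W 3)
    (hadd : Addv W 3) {P : (W.baseChange ℚ_[3]).toAffine.Point} (hP0 : P ≠ 0)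
    (hP : (3 : ℤ) • P = 0) : TypeGOrd W 3 := by
  have hd : ((-1 : ℚ) ^ ((3 : ℕ) / 2) * (3 : ℕ)) ≠ 0 := by norm_num
  obtain ⟨V, iV, iVm, C₁, hC₁⟩ := exists_globallyMinimal_model_twist W hd
  have hV : V.HasGoodReductionAtPrime 3 :=
    hasGoodReductionAtPrime_twist_three_of_typeG_of_addv W hG hadd V ⟨C₁, hC₁⟩
  obtain ⟨C, hC⟩ := exists_variableChange_twist_of_model_twist W hd hC₁
  have hC' : ∃ C : VariableChange ℚ, C • V.quadraticTwist (-3) = W :=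
    ⟨C, by have h := hC; norm_num at h ⊢; exact h⟩
  exact typeGOrd_of_goodOrd_quadraticTwist W 3 (by norm_num) V C₁ hC₁
    (goodOrd_of_model_twist_of_three_zsmul_eq_zero W V hC' hV hP0 hP)

/-! ## §4 `ReductionNonAnomalous W 3 ⟹ E(ℚ₃)[3] = 0 ∧ t = 0` on the (G)-cell -/

/-- **On the (G)-cell at `3`, `ReductionNonAnomalous W 3 ⟹ E(ℚ₃)[3] = 0`.**
[cite: Delbourgo2002, p. 39 (definition of ℓ_p(E)); Mazur1977, Ch. III §5, Step 1, p. 158 (method)] -/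
theorem TypeG.eq_zero_of_three_nsmul_eq_zero_of_reductionNonAnomalous [Fact (Nat.Prime 3)]
    (hG : TypeG W 3) (hadd : Addv W 3) (hR : Delbourgo2002.ReductionNonAnomalous W 3)
    {P : (W.baseChange ℚ_[3]).toAffine.Point} (hP : (3 : ℕ) • P = 0) : P = 0 := by
  by_contra hP0
  exact hG.not_reductionNonAnomalous_three_of_prime_zsmul_eq_zero hadd hP0
    (by rw [show (3 : ℤ) = ((3 : ℕ) : ℤ) from rfl, natCast_zsmul]; exact hP) hR

/-- **On the (G)-cell at `3`, `ReductionNonAnomalous W 3 ⟹ E(ℚ)[3] = 0`** (`E(ℚ) ↪ E(ℚ₃)`).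
[cite: Delbourgo2002, p. 39 (definition of ℓ_p(E)); Mazur1977, Ch. III §5, Step 1, p. 158 (method)] -/
theorem TypeG.eq_zero_of_three_zsmul_eq_zero_rat_of_reductionNonAnomalous [Fact (Nat.Prime 3)]
    (hG : TypeG W 3) (hadd : Addv W 3) (hR : Delbourgo2002.ReductionNonAnomalous W 3)
    {P : W.toAffine.Point} (hP : (3 : ℤ) • P = 0) : P = 0 := by
  have hinj : Function.Injective (W.toPadicPoint 3) :=
    Affine.Point.map_injective (W' := W) (Algebra.ofId ℚ ℚ_[3])
  apply hinj
  rw [map_zero]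
  refine hG.eq_zero_of_three_nsmul_eq_zero_of_reductionNonAnomalous hadd hR ?_
  rw [← map_nsmul, show (3 : ℕ) • P = (3 : ℤ) • P from (natCast_zsmul P 3).symm, hP, map_zero]

/-- **On the (G)-cell at `3`, `ReductionNonAnomalous W 3 ⟹ 3 ∤ #E(ℚ)_tors`.**
[cite: Delbourgo2002, p. 39 (definition of ℓ_p(E)); Mazur1977, Ch. III §5, Step 1, p. 158 (method)] -/
theorem TypeG.not_dvd_torsionOrder_three_of_reductionNonAnomalous [Fact (Nat.Prime 3)]
    (hG : TypeG W 3) (hadd : Addv W 3) (hR : Delbourgo2002.ReductionNonAnomalous W 3) :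
    ¬ 3 ∣ W.torsionOrder :=
  not_dvd_torsionOrder_of_noPTorsion W 3
    (fun _ hQ => hG.eq_zero_of_three_nsmul_eq_zero_of_reductionNonAnomalous hadd hR hQ)

/-- **On the (G)-cell at `3`, `ReductionNonAnomalous W 3 ⟹ t = ord₃ #E(ℚ)_tors = 0`**: under the
proviso of Delbourgo (B) clause 3 that makes `ℓ = 1` the torsion term vanishes too — at `p = 3`,
where `3`-torsion is otherwise the rule on the (G)-cell.
[cite: Delbourgo2002, p. 39 (definition of ℓ_p(E)); Mazur1977, Ch. III §5, Step 1, p. 158 (method)] -/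
theorem TypeG.padicValNat_torsionOrder_three_eq_zero_of_reductionNonAnomalous [Fact (Nat.Prime 3)]
    (hG : TypeG W 3) (hadd : Addv W 3) (hR : Delbourgo2002.ReductionNonAnomalous W 3) :
    padicValNat 3 W.torsionOrder = 0 :=
  padicValNat.eq_zero_of_not_dvd (hG.not_dvd_torsionOrder_three_of_reductionNonAnomalous hadd hR)

/-- (G)-ordinary form at `3`: **`TypeGOrd ∧ ReductionNonAnomalous ⟹ t = 0`**.
[cite: Delbourgo2002, p. 39 (definition of ℓ_p(E)); Delbourgo1998, §1.5] -/
theorem TypeGOrd.padicValNat_torsionOrder_three_eq_zero_of_reductionNonAnomalous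
    [Fact (Nat.Prime 3)] (hG : TypeGOrd W 3) (hadd : Addv W 3)
    (hR : Delbourgo2002.ReductionNonAnomalous W 3) : padicValNat 3 W.torsionOrder = 0 :=
  hG.typeG.padicValNat_torsionOrder_three_eq_zero_of_reductionNonAnomalous hadd hR

/-! ## §5 Class level at `3`: X3♯(G-ord), X4♯(G-ord) -/

/-- **X3♯(G-ord) at `3`, off the anomalous rows: `t = ord₃ #E(ℚ)_tors = 0`.**
[cite: Delbourgo2002, p. 39 (definition of ℓ_p(E)); Delbourgo1998, §1.5] -/
theorem ClassX3Gord.padicValNat_torsionOrder_three_eq_zero_of_reductionNonAnomalous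
    [Fact (Nat.Prime 3)] (hX : ClassX3Gord W 3) (hR : Delbourgo2002.ReductionNonAnomalous W 3) :
    padicValNat 3 W.torsionOrder = 0 :=
  hX.2.typeG.padicValNat_torsionOrder_three_eq_zero_of_reductionNonAnomalous hX.1.2 hR

/-- **X3♯(G-ord) at `3`, off the anomalous rows: `E(ℚ₃)[3] = 0`.**
[cite: Delbourgo2002, p. 39 (definition of ℓ_p(E)); Delbourgo1998, §1.5] -/
theorem ClassX3Gord.eq_zero_of_three_nsmul_eq_zero_of_reductionNonAnomalous [Fact (Nat.Prime 3)]
    (hX : ClassX3Gord W 3) (hR : Delbourgo2002.ReductionNonAnomalous W 3)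
    {P : (W.baseChange ℚ_[3]).toAffine.Point} (hP : (3 : ℕ) • P = 0) : P = 0 :=
  hX.2.typeG.eq_zero_of_three_nsmul_eq_zero_of_reductionNonAnomalous hX.1.2 hR hP

/-- **X4♯(G-ord) at `3`, off the anomalous rows: `t = 0`** (with the LOCAL `E(ℚ₃)[3] = 0`).
[cite: Delbourgo2002, p. 39 (definition of ℓ_p(E)); Delbourgo1998, §1.5] -/
theorem ClassX4Gord.padicValNat_torsionOrder_three_eq_zero_of_reductionNonAnomalous
    [Fact (Nat.Prime 3)] (hX : ClassX4Gord W 3) (hR : Delbourgo2002.ReductionNonAnomalous W 3) :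
    padicValNat 3 W.torsionOrder = 0 :=
  hX.2.typeG.padicValNat_torsionOrder_three_eq_zero_of_reductionNonAnomalous hX.1.2.1 hR

/-- **X4♯(G-ord) at `3`, off the anomalous rows: `E(ℚ₃)[3] = 0`.**
[cite: Delbourgo2002, p. 39 (definition of ℓ_p(E)); Delbourgo1998, §1.5] -/
theorem ClassX4Gord.eq_zero_of_three_nsmul_eq_zero_of_reductionNonAnomalous [Fact (Nat.Prime 3)]
    (hX : ClassX4Gord W 3) (hR : Delbourgo2002.ReductionNonAnomalous W 3)
    {P : (W.baseChange ℚ_[3]).toAffine.Point} (hP : (3 : ℕ) • P = 0) : P = 0 :=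
  hX.2.typeG.eq_zero_of_three_nsmul_eq_zero_of_reductionNonAnomalous hX.1.2.1 hR hP

/-- **The anomalous locus absorbs the torsion locus at `3`, class level**: on X3♯(G-ord) a
`ℚ₃`-point `P ≠ O` with `3 • P = O` ⟹ `¬ ReductionNonAnomalous W 3` (the row carries the flag
`Del02-ThmB-ellp-anomalous`). [cite: Delbourgo2002, p. 39 (definition of ℓ_p(E)); Delbourgo1998, §1.5] -/
theorem ClassX3Gord.not_reductionNonAnomalous_three_of_prime_zsmul_eq_zero [Fact (Nat.Prime 3)]
    (hX : ClassX3Gord W 3) {P : (W.baseChange ℚ_[3]).toAffine.Point} (hP0 : P ≠ 0)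
    (hP : (3 : ℤ) • P = 0) : ¬ Delbourgo2002.ReductionNonAnomalous W 3 :=
  hX.2.typeG.not_reductionNonAnomalous_three_of_prime_zsmul_eq_zero hX.1.2 hP0 hP

/-- X4♯(G-ord) at `3`: `3`-torsion in `E(ℚ₃)` ⟹ `¬ ReductionNonAnomalous W 3`.
[cite: Delbourgo2002, p. 39 (definition of ℓ_p(E)); Delbourgo1998, §1.5] -/
theorem ClassX4Gord.not_reductionNonAnomalous_three_of_prime_zsmul_eq_zero [Fact (Nat.Prime 3)]
    (hX : ClassX4Gord W 3) {P : (W.baseChange ℚ_[3]).toAffine.Point} (hP0 : P ≠ 0)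
    (hP : (3 : ℤ) • P = 0) : ¬ Delbourgo2002.ReductionNonAnomalous W 3 :=
  hX.2.typeG.not_reductionNonAnomalous_three_of_prime_zsmul_eq_zero hX.1.2.1 hP0 hP

end Summit.BirchSwinnertonDyer.Rank1Residual.Additive

end
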